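import Mathlib.Analysis.Calculus.InverseFunctionTheorem.ContDiff
import Mathlib.Analysis.Calculus.Deriv.MeanValue
import Mathlib.Analysis.Calculus.Deriv.Inv
import Mathlib.Analysis.Calculus.Deriv.Slope
import Mathlib.Analysis.SpecialFunctions.SmoothTransition
import Mathlib.Analysis.InnerProductSpace.Calculus
import Mathlib.Order.Monotone.Union
import HarnessLib

/-!
# Radial diffeomorphisms of Euclidean space: a ball contraction and a puncture expansion

Topic `Literature/Topology/FourManifolds`. Model-space (pure calculus) toolkit for the standard
model of **`X # Sⁿ ≅ X`** (`ConnectedSumSphereIdentity.lean`, which discharges the named facts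
`Literature.Topology.FourManifolds.nonempty_diffeomorph_of_isConnectedSum_sphere` of `CorkDecompositionSplitting.lean` and
`Literature.Topology.FourManifolds.isConnectedSum_sphere_self` of `ConnectedSum.lean`). Everything here lives in a real inner
product space `E` (the norm must be smooth away from `0`); no manifolds occur.

## Informal content

1. **Left inverses of étale maps** (§1, `contDiffAt_leftInverse`): if `f` is `Cⁿ` at `a`
   (`n ≥ 1`) with invertible derivative there and `g ∘ f = id`, then `g` is `Cⁿ` at `f a` — near
   `f a`, `g` agrees with the local inverse of the inverse function theorem. Used to see that the
   inverses of the strictly monotone profiles below are smooth.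
2. **Radial maps** (§2, `radialMap φ : z ↦ (φ ‖z‖ / ‖z‖) • z`, i.e. `t • u ↦ φ t • u` for unit
   vectors `u`): elementary algebra, commutation with linear isometries, smoothness away from
   `0`, and linearity near `0` when the profile is linear near `0`.
3. **Two profiles** (§3). The cut-off `χ ρ = smoothTransition ((ρ - 8) / 8)` and
   * the *ball profile* `ψ ρ = ρ / 32 + χ ρ · (1 - 4 / ρ - ρ / 32)`: `ψ ρ = ρ / 32` for `ρ ≤ 8`,
     `ψ ρ = 1 - 4 / ρ` for `ρ ≥ 16`, `ψ' > 0` on `(0, ∞)`, `ψ` maps `(0, ∞)` onto `(0, 1)`, with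
     smooth inverse `ψ⁻¹` there (`ballProfile*`, `ballProfileInv`);
   * the *puncture profile* `η t = ψ (4 / (1 - t))` for `t ≤ 3/4` and `η t = t` for `t ≥ 3/4`
     (the two branches agree for `3/4 ≤ t < 1`, where `4 / (1 - t) ≥ 16`): strictly increasing,
     `η t = 1 / (8 (1 - t))` for `t ≤ 1/2`, `η` maps `(0, ∞)` onto `(1/8, ∞)` with smooth inverse
     (`punctureProfile*`, `punctureProfileInv`).
4. **Two maps** (§4).
   * The *ball contraction* `g = radialMap ψ : E → B(0, 1)` (`ballContraction`): a smooth
     bijection onto the open unit ball with smooth inverse there, equal to `(1/32) • id` near `0`;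
     packaged as `ballContractionPartialHomeomorph` (source `univ`, target `ball 0 1`).
   * The *puncture expansion* `h = radialMap η : E ∖ {0} → E ∖ B̄(0, 1/8)` (`punctureExpansion`):
     a diffeomorphism which is the identity on `‖z‖ ≥ 3/4`; packaged as
     `punctureExpansionPartialHomeomorph`.
   * **The link** (`punctureExpansion_smul_eq`): `h (t • u) = g ((4 / (1 - t)) • u)` for
     `0 < t < 1`, `‖u‖ = 1`. In the standard model of `X # Sⁿ ≅ X` the disc of `X` is punctured
     and opened up by `h`, the complement of the centre `-v` of the round disc of `Sⁿ` is mapped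
     onto the unit ball of `X` by `g ∘ σᵥ ∘ R` (`R` the reflection in `vᗮ`, which reads
     `z ↦ 4 z / ‖z‖²` in the chart `σᵥ`, so that `(1 - t) • u ↦ (4 / (1 - t)) • u`), and the link
     says precisely that the two pieces meet along Kervaire–Milnor's relation
     `t • u ∼ (1 - t) • u` (Kervaire–Milnor 1963, §2; Kosinski, *Differential Manifolds*, VI.1.3).

## Design

All maps are total functions `E → E` (`radialMap`), with `0 ↦ 0`; the partial homeomorphisms
record the intended domains. The numerical constants (`8`, `16`, `32`, `1/8`, `3/4`) are fixed
once and for all — a single instance of the construction is needed downstream — and the inverse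
profiles are `Function.invFun` of the (injective) profiles. `E` is a real inner product space so
that `‖·‖` is smooth away from `0` (Mathlib `contDiffAt_norm`).

## References

* M. A. Kervaire, J. W. Milnor, *Groups of homotopy spheres: I*, Ann. of Math. (2) 77 (1963),
  504–537, §2 [KervaireMilnor1963].
* A. A. Kosinski, *Differential Manifolds*, Academic Press (1993), Ch. VI, §1 [Kosinski1993].
-/

open scoped ContDiff Topology
open Set Function Metric

noncomputable section

namespace Literature.Topology.FourManifolds

/-! ### §1 Left inverses of injective étale maps are smooth -/

section LeftInverse

variable {𝕂 : Type*} [RCLike 𝕂] {E F : Type*} [NormedAddCommGroup E] [NormedSpace 𝕂 E]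
  [CompleteSpace E] [NormedAddCommGroup F] [NormedSpace 𝕂 F] {n : WithTop ℕ∞}

/-- **A left inverse of an injective `Cⁿ` map with invertible derivative is `Cⁿ` at image
points** (`n ≥ 1`): near `f a` the left inverse agrees with the local inverse furnished by the
inverse function theorem. [folklore] -/
theorem contDiffAt_leftInverse {f : E → F} {g : F → E} {f' : E ≃L[𝕂] F} {a : E}
    (hf : ContDiffAt 𝕂 n f a) (hf' : HasFDerivAt f (f' : E →L[𝕂] F) a) (hn : n ≠ 0)
    (hg : LeftInverse g f) : ContDiffAt 𝕂 n g (f a) := by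
  set Φ := hf.toOpenPartialHomeomorph f hf' hn with hΦ
  have hev : g =ᶠ[𝓝 (f a)] Φ.symm := by
    filter_upwards [Φ.open_target.mem_nhds (hf.image_mem_toOpenPartialHomeomorph_target hf' hn)]
      with y hy
    have h1 : f (Φ.symm y) = y := Φ.right_inv hy
    calc g y = g (f (Φ.symm y)) := by rw [h1]
      _ = Φ.symm y := hg _
  exact (hf.to_localInverse hf' hn).congr_of_eventuallyEq hev

/-- One-variable form of `contDiffAt_leftInverse`: a left inverse of a `Cⁿ`
function (`n ≥ 1`) with nonvanishing derivative at `a` is `Cⁿ` at `f a`. [folklore] -/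
theorem contDiffAt_leftInverse_of_hasDerivAt {f g : 𝕂 → 𝕂} {f' a : 𝕂}
    (hf : ContDiffAt 𝕂 n f a) (hf' : HasDerivAt f f' a) (h0 : f' ≠ 0) (hn : n ≠ 0)
    (hg : LeftInverse g f) : ContDiffAt 𝕂 n g (f a) :=
  contDiffAt_leftInverse hf (hf'.hasFDerivAt_equiv h0) hn hg

end LeftInverse

/-! ### §2 Radial maps -/

section Radial

variable {E : Type*} [NormedAddCommGroup E] [InnerProductSpace ℝ E]

/-- The radial map with profile `φ`: `z ↦ (φ ‖z‖ / ‖z‖) • z`, i.e. `t • u ↦ φ t • u` for unit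
vectors `u` and `t > 0` (and `0 ↦ 0`). [folklore] -/
def radialMap (φ : ℝ → ℝ) (z : E) : E := (φ ‖z‖ * ‖z‖⁻¹) • z

/-- A radial map fixes the origin. [folklore] -/
theorem radialMap_zero (φ : ℝ → ℝ) : radialMap φ (0 : E) = 0 := smul_zero _

/-- `‖radialMap φ z‖ = |φ ‖z‖|` for `z ≠ 0`. [folklore] -/
theorem norm_radialMap (φ : ℝ → ℝ) {z : E} (hz : z ≠ 0) : ‖radialMap φ z‖ = |φ ‖z‖| := by
  rw [radialMap, norm_smul, Real.norm_eq_abs, abs_mul, abs_inv, abs_norm, mul_assoc,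
    inv_mul_cancel₀ (norm_ne_zero_iff.2 hz), mul_one]

/-- `radialMap φ (t • u) = φ t • u` for a unit vector `u` and `t > 0`. [folklore] -/
theorem radialMap_smul (φ : ℝ → ℝ) {u : E} (hu : ‖u‖ = 1) {t : ℝ} (ht : 0 < t) :
    radialMap φ (t • u) = φ t • u := by
  rw [radialMap, norm_smul, hu, mul_one, Real.norm_of_nonneg ht.le, smul_smul, mul_assoc,
    inv_mul_cancel₀ ht.ne', mul_one]

/-- Composition of radial maps: `radialMap φ (radialMap ψ z) = (φ (ψ ‖z‖) / ‖z‖) • z` when `ψ ‖z‖ >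
0`. [folklore] -/
theorem radialMap_radialMap (φ ψ : ℝ → ℝ) {z : E} (hz : z ≠ 0) (hψ : 0 < ψ ‖z‖) :
    radialMap φ (radialMap ψ z) = (φ (ψ ‖z‖) * ‖z‖⁻¹) • z := by
  rw [radialMap, norm_radialMap ψ hz, abs_of_pos hψ, radialMap, smul_smul]
  congr 1
  have hz' : ‖z‖ ≠ 0 := norm_ne_zero_iff.2 hz
  field_simp

/-- A radial map fixes the points at whose norm its profile is the identity. [folklore] -/
theorem radialMap_eq_self (φ : ℝ → ℝ) {z : E} (h : φ ‖z‖ = ‖z‖) : radialMap φ z = z := by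
  rcases eq_or_ne z 0 with rfl | hz
  · exact radialMap_zero φ
  · rw [radialMap, h, mul_inv_cancel₀ (norm_ne_zero_iff.2 hz), one_smul]

/-- Radial maps commute with linear isometries. [folklore] -/
theorem radialMap_linearIsometryEquiv (φ : ℝ → ℝ) (S : E ≃ₗᵢ[ℝ] E) (z : E) :
    radialMap φ (S z) = S (radialMap φ z) := by
  simp [radialMap, S.norm_map]

/-- Away from the origin a radial map is `Cⁿ` wherever its profile is `Cⁿ` at the norm.
[folklore] -/
theorem contDiffAt_radialMap {φ : ℝ → ℝ} {n : WithTop ℕ∞} {z : E} (hz : z ≠ 0)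
    (hφ : ContDiffAt ℝ n φ ‖z‖) : ContDiffAt ℝ n (radialMap φ) z := by
  have hn : ContDiffAt ℝ n (fun z : E => ‖z‖) z := contDiffAt_norm ℝ hz
  exact ((hφ.comp z hn).mul (hn.inv (norm_ne_zero_iff.2 hz))).smul contDiffAt_id

/-- A radial map whose profile is linear of slope `c` near `0` is `c • id` near `0`. [folklore] -/
theorem radialMap_eq_smul_of_norm_lt (φ : ℝ → ℝ) {c r : ℝ} (hφ : ∀ t, 0 < t → t < r → φ t = c * t)
    {z : E} (hz : ‖z‖ < r) : radialMap φ z = c • z := by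
  rcases eq_or_ne z 0 with rfl | hz0
  · rw [radialMap_zero, smul_zero]
  · have hzn : 0 < ‖z‖ := norm_pos_iff.2 hz0
    rw [radialMap, hφ _ hzn hz, mul_assoc, mul_inv_cancel₀ hzn.ne', mul_one]

end Radial

/-! ### §3 The two profiles -/

section Profiles

open Real

/-- The cut-off `χ(ρ) = smoothTransition ((ρ - 8) / 8)`: `0` for `ρ ≤ 8`, `1` for `ρ ≥ 16`,
monotone and smooth. [folklore] -/
def transitionCut (ρ : ℝ) : ℝ := smoothTransition ((ρ - 8) / 8)

/-- `χ ρ = 0` for `ρ ≤ 8`. [folklore] -/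
theorem transitionCut_of_le {ρ : ℝ} (h : ρ ≤ 8) : transitionCut ρ = 0 :=
  smoothTransition.zero_of_nonpos (by linarith)

/-- `χ ρ = 1` for `ρ ≥ 16`. [folklore] -/
theorem transitionCut_of_ge {ρ : ℝ} (h : 16 ≤ ρ) : transitionCut ρ = 1 :=
  smoothTransition.one_of_one_le (by rw [le_div_iff₀ (by norm_num : (0 : ℝ) < 8)]; linarith)

/-- `0 ≤ χ`. [folklore] -/
theorem transitionCut_nonneg (ρ : ℝ) : 0 ≤ transitionCut ρ := smoothTransition.nonneg _

/-- `χ ≤ 1`. [folklore] -/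
theorem transitionCut_le_one (ρ : ℝ) : transitionCut ρ ≤ 1 := smoothTransition.le_one _

/-- `χ` is monotone. [folklore] -/
theorem transitionCut_monotone : Monotone transitionCut := fun _ _ hab =>
  smoothTransition.monotone (div_le_div_of_nonneg_right (by linarith) (by norm_num))

/-- `χ` is smooth. [folklore] -/
theorem contDiff_transitionCut {n : ℕ∞} : ContDiff ℝ n transitionCut :=
  smoothTransition.contDiff.comp ((contDiff_id.sub contDiff_const).div_const _)

/-- `χ` is differentiable. [folklore] -/
theorem differentiable_transitionCut : Differentiable ℝ transitionCut :=
  (contDiff_transitionCut (n := 1)).differentiable one_ne_zero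

/-- `χ' ≥ 0`. [folklore] -/
theorem deriv_transitionCut_nonneg (ρ : ℝ) : 0 ≤ deriv transitionCut ρ :=
  (differentiable_transitionCut ρ).hasDerivAt.nonneg_of_monotone transitionCut_monotone

/-- `χ' ρ = 0` for `ρ < 8`. [folklore] -/
theorem deriv_transitionCut_of_lt {ρ : ℝ} (h : ρ < 8) : deriv transitionCut ρ = 0 := by
  have : transitionCut =ᶠ[𝓝 ρ] fun _ => 0 :=
    Filter.eventuallyEq_of_mem (Iio_mem_nhds h) fun x hx => transitionCut_of_le (le_of_lt hx)
  rw [this.deriv_eq, deriv_const]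

/-- `χ' ρ = 0` for `ρ > 16`. [folklore] -/
theorem deriv_transitionCut_of_gt {ρ : ℝ} (h : 16 < ρ) : deriv transitionCut ρ = 0 := by
  have : transitionCut =ᶠ[𝓝 ρ] fun _ => 1 :=
    Filter.eventuallyEq_of_mem (Ioi_mem_nhds h) fun x hx => transitionCut_of_ge (le_of_lt hx)
  rw [this.deriv_eq, deriv_const]

/-- The **ball profile** `ψ(ρ) = (1 - χ ρ) ρ / 32 + χ ρ (1 - 4/ρ)`: equal to `ρ / 32` for `ρ ≤ 8`
and to `1 - 4/ρ` for `ρ ≥ 16`; a strictly increasing smooth bijection `(0, ∞) → (0, 1)` with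
positive derivative. It is the norm profile of the contraction `ℝⁿ ≅ B(0, 1)` used to fill the
hole of a connected sum with a sphere. [folklore] -/
def ballProfile (ρ : ℝ) : ℝ := ρ / 32 + transitionCut ρ * (1 - 4 / ρ - ρ / 32)

/-- `ψ ρ = ρ / 32` for `ρ ≤ 8`. [folklore] -/
theorem ballProfile_of_le {ρ : ℝ} (h : ρ ≤ 8) : ballProfile ρ = ρ / 32 := by
  rw [ballProfile, transitionCut_of_le h, zero_mul, add_zero]

/-- `ψ ρ = 1 - 4 / ρ` for `ρ ≥ 16`. [folklore] -/
theorem ballProfile_of_ge {ρ : ℝ} (h : 16 ≤ ρ) : ballProfile ρ = 1 - 4 / ρ := by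
  rw [ballProfile, transitionCut_of_ge h]; ring

/-- `ψ 0 = 0`. [folklore] -/
theorem ballProfile_zero : ballProfile 0 = 0 := by
  rw [ballProfile_of_le (by norm_num)]; simp

/-- `ψ 8 = 1 / 4`. [folklore] -/
theorem ballProfile_eight : ballProfile 8 = 1 / 4 := by
  rw [ballProfile_of_le le_rfl]; norm_num

/-- `ψ 16 = 3 / 4`. [folklore] -/
theorem ballProfile_sixteen : ballProfile 16 = 3 / 4 := by
  rw [ballProfile_of_ge le_rfl]; norm_num

/-- `ψ 4 = 1 / 8`. [folklore] -/
theorem ballProfile_four : ballProfile 4 = 1 / 8 := by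
  rw [ballProfile_of_le (by norm_num)]; norm_num

/-- `0 < ψ ρ < 1` for `ρ > 0`. [folklore] -/
theorem ballProfile_mem_Ioo {ρ : ℝ} (h : 0 < ρ) : ballProfile ρ ∈ Ioo (0 : ℝ) 1 := by
  have h0 := transitionCut_nonneg ρ
  have h1 := transitionCut_le_one ρ
  rcases le_or_gt ρ 8 with h8 | h8
  · rw [ballProfile_of_le h8]; constructor <;> linarith
  rcases le_or_gt 16 ρ with h16 | h16
  · rw [ballProfile_of_ge h16]
    have : 4 / ρ ≤ 4 / 16 := div_le_div_of_nonneg_left (by norm_num) (by norm_num) h16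
    have : 0 < 4 / ρ := by positivity
    constructor <;> linarith
  · -- 8 < ρ < 16 : convex combination of `ρ/32 ∈ (1/4, 1/2)` and `1 - 4/ρ ∈ (1/2, 3/4)`
    have hA : ballProfile ρ = (1 - transitionCut ρ) * (ρ / 32) + transitionCut ρ * (1 - 4 / ρ) := by
      rw [ballProfile]; ring
    have h4 : 4 / ρ < 4 / 8 := div_lt_div_of_pos_left (by norm_num) (by norm_num) h8
    have h4' : 4 / 16 < 4 / ρ := div_lt_div_of_pos_left (by norm_num) h h16
    rw [hA]
    constructor <;> nlinarith

/-- `0 < ψ ρ` for `ρ > 0`. [folklore] -/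
theorem ballProfile_pos {ρ : ℝ} (h : 0 < ρ) : 0 < ballProfile ρ := (ballProfile_mem_Ioo h).1

/-- `ψ ρ < 1` for `ρ > 0`. [folklore] -/
theorem ballProfile_lt_one {ρ : ℝ} (h : 0 < ρ) : ballProfile ρ < 1 := (ballProfile_mem_Ioo h).2

/-- `0 ≤ ψ ρ` for `ρ ≥ 0`. [folklore] -/
theorem ballProfile_nonneg {ρ : ℝ} (h : 0 ≤ ρ) : 0 ≤ ballProfile ρ := by
  rcases h.eq_or_lt with rfl | h
  · rw [ballProfile_zero]
  · exact (ballProfile_pos h).le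

/-- `ψ` is smooth away from `0`. [folklore] -/
theorem contDiffAt_ballProfile {ρ : ℝ} (h : ρ ≠ 0) : ContDiffAt ℝ ∞ ballProfile ρ := by
  have h1 : ContDiffAt ℝ ∞ (fun ρ : ℝ => 1 - 4 / ρ - ρ / 32) ρ :=
    (contDiffAt_const.sub (contDiffAt_const.div contDiffAt_id h)).sub (contDiffAt_id.div_const _)
  show ContDiffAt ℝ ∞ (fun ρ : ℝ => ρ / 32 + transitionCut ρ * (1 - 4 / ρ - ρ / 32)) ρ
  exact (contDiffAt_id.div_const _).add ((contDiff_transitionCut (n := ⊤)).contDiffAt.mul h1)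

/-- The derivative of `ψ` at `ρ ≠ 0`. [folklore] -/
theorem hasDerivAt_ballProfile {ρ : ℝ} (h : ρ ≠ 0) :
    HasDerivAt ballProfile (1 / 32 + (deriv transitionCut ρ * (1 - 4 / ρ - ρ / 32) +
      transitionCut ρ * (4 / ρ ^ 2 - 1 / 32))) ρ := by
  have hχ : HasDerivAt transitionCut (deriv transitionCut ρ) ρ :=
    (differentiable_transitionCut ρ).hasDerivAt
  have hD : HasDerivAt (fun ρ : ℝ => 1 - 4 / ρ - ρ / 32) (4 / ρ ^ 2 - 1 / 32) ρ := by
    have h1 := (((hasDerivAt_const ρ (1 : ℝ)).sub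
      ((hasDerivAt_const ρ (4 : ℝ)).div (hasDerivAt_id' ρ) h)).sub
        ((hasDerivAt_id' ρ).div_const 32))
    refine h1.congr_deriv ?_
    field_simp
    ring
  have h2 : HasDerivAt (fun ρ : ℝ => ρ / 32) (1 / 32) ρ := by
    simpa using (hasDerivAt_id' ρ).div_const 32
  exact h2.add (hχ.mul hD)

/-- The derivative of `ψ` is positive on `(0, ∞)`. [folklore] -/
theorem deriv_ballProfile_pos {ρ : ℝ} (h : 0 < ρ) :
    0 < 1 / 32 + (deriv transitionCut ρ * (1 - 4 / ρ - ρ / 32) +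
      transitionCut ρ * (4 / ρ ^ 2 - 1 / 32)) := by
  have hχ0 := transitionCut_nonneg ρ
  have hχ1 := transitionCut_le_one ρ
  have hχ' := deriv_transitionCut_nonneg ρ
  have hkey : 0 ≤ deriv transitionCut ρ * (1 - 4 / ρ - ρ / 32) := by
    rcases lt_or_ge ρ 8 with h8 | h8
    · rw [deriv_transitionCut_of_lt h8, zero_mul]
    rcases lt_or_ge 16 ρ with h16 | h16
    · rw [deriv_transitionCut_of_gt h16, zero_mul]
    · refine mul_nonneg hχ' ?_
      have hrw : 1 - 4 / ρ - ρ / 32 = (32 * ρ - 128 - ρ ^ 2) / (32 * ρ) := by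
        field_simp
        ring
      rw [hrw]
      exact div_nonneg (by nlinarith) (by positivity)
  have hpos : 0 < 4 / ρ ^ 2 := by positivity
  have hprod : 0 ≤ transitionCut ρ * (4 / ρ ^ 2) := mul_nonneg hχ0 hpos.le
  rcases hχ1.lt_or_eq with hlt | heq
  · nlinarith
  · rw [heq]
    linarith

/-- `0 < ψ' ρ` for `ρ > 0` (`deriv` form). [folklore] -/
theorem deriv_ballProfile_pos' {ρ : ℝ} (h : 0 < ρ) : 0 < deriv ballProfile ρ := by
  rw [(hasDerivAt_ballProfile h.ne').deriv]; exact deriv_ballProfile_pos h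

/-- `ψ` is continuous on `(0, ∞)`. [folklore] -/
theorem continuousOn_ballProfile_Ioi : ContinuousOn ballProfile (Ioi 0) := fun _ hρ =>
  (contDiffAt_ballProfile (ne_of_gt hρ)).continuousAt.continuousWithinAt

/-- `ψ` is strictly monotone on `(0, ∞)` (positive derivative). [folklore] -/
theorem strictMonoOn_ballProfile : StrictMonoOn ballProfile (Ioi 0) :=
  strictMonoOn_of_deriv_pos (convex_Ioi 0) continuousOn_ballProfile_Ioi fun x hx =>
    deriv_ballProfile_pos' (by simpa using hx)

/-- `ψ` is strictly increasing on the whole line (it is linear on `(-∞, 8]`). [folklore] -/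
theorem strictMono_ballProfile : StrictMono ballProfile := by
  refine StrictMonoOn.Iic_union_Ici (a := 8) (fun a ha b hb hab => ?_)
    (strictMonoOn_ballProfile.mono fun x hx => lt_of_lt_of_le (by norm_num : (0 : ℝ) < 8) hx)
  rw [ballProfile_of_le ha, ballProfile_of_le hb]
  linarith

/-- `ψ` is injective. [folklore] -/
theorem injective_ballProfile : Injective ballProfile := strictMono_ballProfile.injective

/-- `ψ` maps `(0, ∞)` onto `(0, 1)`. [folklore] -/
theorem exists_ballProfile_eq {s : ℝ} (hs : s ∈ Ioo (0 : ℝ) 1) :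
    ∃ ρ, 0 < ρ ∧ ballProfile ρ = s := by
  rcases le_or_gt s (1 / 4) with h1 | h1
  · exact ⟨32 * s, by linarith [hs.1], by rw [ballProfile_of_le (by linarith)]; ring⟩
  rcases le_or_gt (3 / 4) s with h2 | h2
  · refine ⟨4 / (1 - s), div_pos (by norm_num) (by linarith [hs.2]), ?_⟩
    have h1s : 0 < 1 - s := by linarith [hs.2]
    rw [ballProfile_of_ge]
    · field_simp; ring
    · rw [le_div_iff₀ h1s]; linarith
  · have hc : ContinuousOn ballProfile (Icc 8 16) :=
      continuousOn_ballProfile_Ioi.mono fun x hx => lt_of_lt_of_le (by norm_num : (0 : ℝ) < 8) hx.1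
    have hmem : s ∈ Icc (ballProfile 8) (ballProfile 16) := by
      rw [ballProfile_eight, ballProfile_sixteen]
      exact ⟨h1.le, h2.le⟩
    obtain ⟨ρ, hρ, hρs⟩ := intermediate_value_Icc (by norm_num : (8:ℝ) ≤ 16) hc hmem
    exact ⟨ρ, lt_of_lt_of_le (by norm_num : (0 : ℝ) < 8) hρ.1, hρs⟩

/-- The inverse profile `ψ⁻¹` (a global left inverse of the injective `ψ`). [folklore] -/
def ballProfileInv : ℝ → ℝ := invFun ballProfile

/-- `ψ⁻¹ (ψ ρ) = ρ`. [folklore] -/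
theorem ballProfileInv_ballProfile (ρ : ℝ) : ballProfileInv (ballProfile ρ) = ρ :=
  leftInverse_invFun injective_ballProfile ρ

/-- `ψ⁻¹` is smooth at `ψ ρ` for `ρ > 0` (inverse function theorem, `ψ' ρ > 0`). [folklore] -/
theorem contDiffAt_ballProfileInv {ρ : ℝ} (h : 0 < ρ) :
    ContDiffAt ℝ ∞ ballProfileInv (ballProfile ρ) :=
  contDiffAt_leftInverse_of_hasDerivAt (contDiffAt_ballProfile h.ne') (hasDerivAt_ballProfile h.ne')
    (deriv_ballProfile_pos h).ne' (by simp) (leftInverse_invFun injective_ballProfile)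

/-- The **puncture profile** `η(t) = ψ (4 / (1 - t))` for `t ≤ 3/4`, `η(t) = t` for `t ≥ 3/4`: a
strictly increasing smooth bijection `(0, ∞) → (1/8, ∞)`, the norm profile of the expansion
`ℝⁿ ∖ 0 ≅ ℝⁿ ∖ B̄(0, 1/8)` opening the puncture of a connected sum, linked to `ψ` through the
stereographic inversion `t ↦ 4 / (1 - t)`. [folklore] -/
def punctureProfile (t : ℝ) : ℝ := if t ≤ 3 / 4 then ballProfile (4 / (1 - t)) else t

/-- `η t = ψ (4 / (1 - t))` for every `t < 1`: the two branches of `η` agree on `[3/4, 1)`.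
[folklore] -/
theorem punctureProfile_of_lt_one {t : ℝ} (h : t < 1) :
    punctureProfile t = ballProfile (4 / (1 - t)) := by
  unfold punctureProfile
  split_ifs with h34
  · rfl
  · have h1t : 0 < 1 - t := by linarith
    rw [ballProfile_of_ge]
    · field_simp; ring
    · rw [le_div_iff₀ h1t]; push Not at h34; linarith

/-- `η t = t` for `t ≥ 3/4`. [folklore] -/
theorem punctureProfile_of_ge {t : ℝ} (h : 3 / 4 ≤ t) : punctureProfile t = t := by
  unfold punctureProfile
  split_ifs with h34
  · have ht : t = 3 / 4 := le_antisymm h34 h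
    subst ht
    have h16 : (4 : ℝ) / (1 - 3 / 4) = 16 := by norm_num
    rw [h16, ballProfile_sixteen]
  · rfl

/-- `η t = 1 / (8 (1 - t))` for `t ≤ 1/2` (the linear branch of `ψ`). [folklore] -/
theorem punctureProfile_of_pos_of_le_half {t : ℝ} (h : t ≤ 1 / 2) :
    punctureProfile t = 1 / (8 * (1 - t)) := by
  have h1t : 0 < 1 - t := by linarith
  rw [punctureProfile_of_lt_one (by linarith), ballProfile_of_le]
  · field_simp; ring
  · rw [div_le_iff₀ h1t]; linarith

/-- `η t > 1/8` for `t > 0`. [folklore] -/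
theorem punctureProfile_gt {t : ℝ} (h : 0 < t) : 1 / 8 < punctureProfile t := by
  rcases lt_or_ge t 1 with h1 | h1
  · rw [punctureProfile_of_lt_one h1, ← ballProfile_four]
    refine strictMono_ballProfile ?_
    have h1t : 0 < 1 - t := by linarith
    rw [lt_div_iff₀ h1t]; linarith
  · rw [punctureProfile_of_ge (by linarith)]; linarith

/-- `0 < η t` for `t > 0`. [folklore] -/
theorem punctureProfile_pos {t : ℝ} (h : 0 < t) : 0 < punctureProfile t :=
  lt_trans (by norm_num) (punctureProfile_gt h)

/-- For `0 < t` with `η t < 1` one has `t < 1` (since `η = id` on `[3/4, ∞)`). [folklore] -/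
theorem lt_one_of_punctureProfile_lt_one {t : ℝ} (h : punctureProfile t < 1) : t < 1 := by
  by_contra h1
  push Not at h1
  rw [punctureProfile_of_ge (by linarith)] at h
  linarith

/-- `η` is strictly monotone. [folklore] -/
theorem strictMono_punctureProfile : StrictMono punctureProfile := by
  refine StrictMonoOn.Iic_union_Ici (a := 3 / 4) (fun a ha b hb hab => ?_) (fun a ha b hb hab => ?_)
  · rw [mem_Iic] at ha hb
    rw [punctureProfile_of_lt_one (by linarith), punctureProfile_of_lt_one (by linarith)]
    refine strictMono_ballProfile ?_
    have hb1 : 0 < 1 - b := by linarith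
    have ha1 : 0 < 1 - a := by linarith
    exact div_lt_div_of_pos_left (by norm_num) hb1 (by linarith)
  · rw [mem_Ici] at ha hb
    rwa [punctureProfile_of_ge ha, punctureProfile_of_ge hb]

/-- `η` is injective. [folklore] -/
theorem injective_punctureProfile : Injective punctureProfile :=
  strictMono_punctureProfile.injective

/-- `η` is smooth on `(0, ∞)` (indeed on `(-∞, 1) ∪ (3/4, ∞) = ℝ`, but only `t > 0` is needed).
[folklore] -/
theorem contDiffAt_punctureProfile {t : ℝ} (ht : 0 < t) :
    ContDiffAt ℝ ∞ punctureProfile t := by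
  rcases lt_or_ge t 1 with h1 | h1
  · have hev : punctureProfile =ᶠ[𝓝 t] fun t => ballProfile (4 / (1 - t)) :=
      Filter.eventuallyEq_of_mem (Iio_mem_nhds h1) fun x hx => punctureProfile_of_lt_one hx
    refine ContDiffAt.congr_of_eventuallyEq ?_ hev
    have h1t : (1 : ℝ) - t ≠ 0 := by linarith
    have hq : ContDiffAt ℝ ∞ (fun t : ℝ => 4 / (1 - t)) t :=
      contDiffAt_const.div (contDiffAt_const.sub contDiffAt_id) h1t
    refine (contDiffAt_ballProfile ?_).comp t hq
    exact div_ne_zero (by norm_num) h1t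
  · have hev : punctureProfile =ᶠ[𝓝 t] id :=
      Filter.eventuallyEq_of_mem (Ioi_mem_nhds (show (3:ℝ)/4 < t by linarith))
        fun x hx => punctureProfile_of_ge (le_of_lt hx)
    exact contDiffAt_id.congr_of_eventuallyEq hev

/-- `η` has a positive derivative at every `t > 0`. [folklore] -/
theorem exists_hasDerivAt_punctureProfile {t : ℝ} (ht : 0 < t) :
    ∃ d, 0 < d ∧ HasDerivAt punctureProfile d t := by
  rcases lt_or_ge t 1 with h1 | h1
  · have hev : punctureProfile =ᶠ[𝓝 t] (ballProfile ∘ fun t => 4 / (1 - t)) :=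
      Filter.eventuallyEq_of_mem (Iio_mem_nhds h1) fun x hx => punctureProfile_of_lt_one hx
    have h1t : 0 < 1 - t := by linarith
    have hq : HasDerivAt (fun t : ℝ => 4 / (1 - t)) (4 / (1 - t) ^ 2) t := by
      refine (((hasDerivAt_const t (4 : ℝ)).div ((hasDerivAt_id' t).const_sub 1)
        h1t.ne')).congr_deriv ?_
      field_simp
      ring
    have hρ : 0 < 4 / (1 - t) := by positivity
    have hc := (hasDerivAt_ballProfile hρ.ne').comp t hq
    exact ⟨_, mul_pos (deriv_ballProfile_pos hρ) (by positivity), hc.congr_of_eventuallyEq hev⟩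
  · have hev : punctureProfile =ᶠ[𝓝 t] id :=
      Filter.eventuallyEq_of_mem (Ioi_mem_nhds (show (3:ℝ)/4 < t by linarith))
        fun x hx => punctureProfile_of_ge (le_of_lt hx)
    exact ⟨1, one_pos, (hasDerivAt_id t).congr_of_eventuallyEq hev⟩

/-- `η` maps `(0, ∞)` onto `(1/8, ∞)`. [folklore] -/
theorem exists_punctureProfile_eq {s : ℝ} (hs : 1 / 8 < s) :
    ∃ t, 0 < t ∧ punctureProfile t = s := by
  rcases le_or_gt (3 / 4) s with h34 | h34
  · exact ⟨s, by linarith, punctureProfile_of_ge h34⟩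
  · obtain ⟨ρ, hρ, hρs⟩ := exists_ballProfile_eq ⟨by linarith, by linarith⟩
    have h4 : 4 < ρ := by
      by_contra h4; push Not at h4
      have := strictMono_ballProfile.monotone h4
      rw [hρs, ballProfile_four] at this
      linarith
    refine ⟨1 - 4 / ρ, by rw [sub_pos, div_lt_one hρ]; exact h4, ?_⟩
    have h4ρ : 0 < 4 / ρ := by positivity
    rw [punctureProfile_of_lt_one (by linarith), ← hρs]
    congr 1
    field_simp; ring

/-- The inverse profile `η⁻¹`. [folklore] -/
def punctureProfileInv : ℝ → ℝ := invFun punctureProfile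

/-- `η⁻¹ (η t) = t`. [folklore] -/
theorem punctureProfileInv_punctureProfile (t : ℝ) : punctureProfileInv (punctureProfile t) = t :=
  leftInverse_invFun injective_punctureProfile t

/-- `η⁻¹` is smooth at `η t` for `t > 0` (inverse function theorem). [folklore] -/
theorem contDiffAt_punctureProfileInv {t : ℝ} (h : 0 < t) :
    ContDiffAt ℝ ∞ punctureProfileInv (punctureProfile t) := by
  obtain ⟨d, hd, hdt⟩ := exists_hasDerivAt_punctureProfile h
  exact contDiffAt_leftInverse_of_hasDerivAt (contDiffAt_punctureProfile h) hdt hd.ne' (by simp)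
    (leftInverse_invFun injective_punctureProfile)

/-- **The link between the two profiles**: `η t = ψ (4 / (1 - t))` for `t < 1`. [folklore] -/
theorem punctureProfile_eq_ballProfile {t : ℝ} (h : t < 1) :
    punctureProfile t = ballProfile (4 / (1 - t)) := punctureProfile_of_lt_one h

end Profiles

/-! ### §4 The contraction `ℝⁿ ≅ B(0,1)` and the expansion `ℝⁿ ∖ 0 ≅ ℝⁿ ∖ B̄(0, 1/8)` -/

section Maps

variable {E : Type*} [NormedAddCommGroup E] [InnerProductSpace ℝ E]

/-- The **ball contraction** `g = radialMap ψ : E → B(0, 1)`, `ρ • u ↦ ψ ρ • u`. [folklore] -/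
def ballContraction : E → E := radialMap ballProfile

/-- The inverse of the ball contraction (on the open unit ball). [folklore] -/
def ballContractionInv : E → E := radialMap ballProfileInv

/-- `g 0 = 0`. [folklore] -/
theorem ballContraction_zero : ballContraction (0 : E) = 0 := radialMap_zero _

/-- `‖g w‖ = ψ ‖w‖`. [folklore] -/
theorem norm_ballContraction (w : E) : ‖ballContraction w‖ = ballProfile ‖w‖ := by
  rcases eq_or_ne w 0 with rfl | hw
  · rw [ballContraction_zero, norm_zero, ballProfile_zero]
  · rw [ballContraction, norm_radialMap _ hw, abs_of_pos (ballProfile_pos (norm_pos_iff.2 hw))]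

/-- `g` maps into the open unit ball. [folklore] -/
theorem norm_ballContraction_lt_one (w : E) : ‖ballContraction w‖ < 1 := by
  rw [norm_ballContraction]
  rcases (norm_nonneg w).eq_or_lt with h | h
  · rw [← h, ballProfile_zero]; exact one_pos
  · exact ballProfile_lt_one h

/-- `g (ρ • u) = ψ ρ • u` for a unit vector `u` and `ρ > 0`. [folklore] -/
theorem ballContraction_smul {u : E} (hu : ‖u‖ = 1) {ρ : ℝ} (hρ : 0 < ρ) :
    ballContraction (ρ • u) = ballProfile ρ • u := radialMap_smul _ hu hρ

/-- `g w = (1/32) • w` for `‖w‖ < 8`: `g` is linear near the origin. [folklore] -/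
theorem ballContraction_eq_smul_of_norm_lt {w : E} (hw : ‖w‖ < 8) :
    ballContraction w = (32 : ℝ)⁻¹ • w :=
  radialMap_eq_smul_of_norm_lt _ (fun t _ ht => by rw [ballProfile_of_le ht.le]; ring) hw

/-- `g` is smooth (linear near the origin, radial with a smooth profile elsewhere). [folklore] -/
theorem contDiff_ballContraction : ContDiff ℝ ∞ (ballContraction : E → E) := by
  rw [contDiff_iff_contDiffAt]
  intro w
  rcases eq_or_ne w 0 with rfl | hw
  · have hev : (ballContraction : E → E) =ᶠ[𝓝 0] fun w => (32 : ℝ)⁻¹ • w :=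
      Filter.eventuallyEq_of_mem (ball_mem_nhds (0 : E) (by norm_num : (0:ℝ) < 8))
        fun w hw => ballContraction_eq_smul_of_norm_lt (by simpa using hw)
    exact (contDiffAt_id.const_smul _).congr_of_eventuallyEq hev
  · exact contDiffAt_radialMap hw (contDiffAt_ballProfile (norm_ne_zero_iff.2 hw))

/-- `g` is continuous. [folklore] -/
theorem continuous_ballContraction : Continuous (ballContraction : E → E) :=
  contDiff_ballContraction.continuous

/-- `g⁻¹ (g w) = w`. [folklore] -/
theorem ballContractionInv_ballContraction (w : E) :
    ballContractionInv (ballContraction w) = w := by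
  rcases eq_or_ne w 0 with rfl | hw
  · rw [ballContraction_zero, ballContractionInv, radialMap_zero]
  · rw [ballContractionInv, ballContraction,
      radialMap_radialMap _ _ hw (ballProfile_pos (norm_pos_iff.2 hw)), ballProfileInv_ballProfile,
      mul_inv_cancel₀ (norm_ne_zero_iff.2 hw), one_smul]

/-- `g` is injective. [folklore] -/
theorem injective_ballContraction : Injective (ballContraction : E → E) :=
  (LeftInverse.injective ballContractionInv_ballContraction)

/-- `g (g⁻¹ y) = y` for `‖y‖ < 1`. [folklore] -/
theorem ballContraction_ballContractionInv {y : E} (hy : ‖y‖ < 1) :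
    ballContraction (ballContractionInv y) = y := by
  rcases eq_or_ne y 0 with rfl | hy0
  · rw [ballContractionInv, radialMap_zero, ballContraction_zero]
  · obtain ⟨ρ, hρ, hρy⟩ := exists_ballProfile_eq ⟨norm_pos_iff.2 hy0, hy⟩
    have hinv : ballProfileInv ‖y‖ = ρ := by rw [← hρy, ballProfileInv_ballProfile]
    rw [ballContraction, ballContractionInv, radialMap_radialMap _ _ hy0 (by rw [hinv]; exact hρ),
      hinv, hρy, mul_inv_cancel₀ (norm_ne_zero_iff.2 hy0), one_smul]

/-- `g⁻¹ y = 32 • y` for `‖y‖ < 1/4`: `g⁻¹` is linear near the origin. [folklore] -/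
theorem ballContractionInv_eq_smul_of_norm_lt {y : E} (hy : ‖y‖ < 4⁻¹) :
    ballContractionInv y = (32 : ℝ) • y := by
  refine radialMap_eq_smul_of_norm_lt _ (fun t _ ht' => ?_) hy
  have h32 : ballProfile (32 * t) = t := by
    rw [ballProfile_of_le (by linarith)]; ring
  calc ballProfileInv t = ballProfileInv (ballProfile (32 * t)) := by rw [h32]
    _ = 32 * t := ballProfileInv_ballProfile _

/-- `g⁻¹` is smooth at the points of the open unit ball. [folklore] -/
theorem contDiffAt_ballContractionInv {y : E} (hy : ‖y‖ < 1) :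
    ContDiffAt ℝ ∞ (ballContractionInv : E → E) y := by
  rcases eq_or_ne y 0 with rfl | hy0
  · have hev : (ballContractionInv : E → E) =ᶠ[𝓝 0] fun y => (32 : ℝ) • y :=
      Filter.eventuallyEq_of_mem (ball_mem_nhds (0 : E) (by norm_num : (0:ℝ) < 4⁻¹))
        fun y hy => ballContractionInv_eq_smul_of_norm_lt (by simpa using hy)
    exact (contDiffAt_id.const_smul _).congr_of_eventuallyEq hev
  · obtain ⟨ρ, hρ, hρy⟩ := exists_ballProfile_eq ⟨norm_pos_iff.2 hy0, hy⟩
    refine contDiffAt_radialMap hy0 ?_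
    rw [← hρy]
    exact contDiffAt_ballProfileInv hρ

/-- `g⁻¹` is smooth on the open unit ball. [folklore] -/
theorem contDiffOn_ballContractionInv : ContDiffOn ℝ ∞ (ballContractionInv : E → E) (ball 0 1) :=
  fun _ hy => (contDiffAt_ballContractionInv (by simpa using hy)).contDiffWithinAt

/-- The ball contraction as a partial homeomorphism `E ≃ B(0, 1)` with source `univ`, smooth with
smooth inverse (`contDiff_ballContraction`, `contDiffOn_ballContractionInv`). [folklore] -/
def ballContractionPartialHomeomorph : OpenPartialHomeomorph E E where
  toFun := ballContraction
  invFun := ballContractionInv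
  source := univ
  target := ball 0 1
  map_source' w _ := by simpa using norm_ballContraction_lt_one w
  map_target' _ _ := mem_univ _
  left_inv' w _ := ballContractionInv_ballContraction w
  right_inv' _ hy := ballContraction_ballContractionInv (by simpa using hy)
  open_source := isOpen_univ
  open_target := isOpen_ball
  continuousOn_toFun := continuous_ballContraction.continuousOn
  continuousOn_invFun := contDiffOn_ballContractionInv.continuousOn

/-- `ballContractionPartialHomeomorph` acts as `g`. [folklore] -/
@[simp] theorem ballContractionPartialHomeomorph_coe :
    ⇑(ballContractionPartialHomeomorph : OpenPartialHomeomorph E E) = ballContraction := rfl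

/-- The inverse of `ballContractionPartialHomeomorph` acts as `g⁻¹`. [folklore] -/
@[simp] theorem ballContractionPartialHomeomorph_symm_coe :
    ⇑(ballContractionPartialHomeomorph : OpenPartialHomeomorph E E).symm = ballContractionInv := rfl

/-- The source of `ballContractionPartialHomeomorph` is everything. [folklore] -/
@[simp] theorem ballContractionPartialHomeomorph_source :
    (ballContractionPartialHomeomorph : OpenPartialHomeomorph E E).source = univ := rfl

/-- The target of `ballContractionPartialHomeomorph` is the open unit ball. [folklore] -/
@[simp] theorem ballContractionPartialHomeomorph_target :
    (ballContractionPartialHomeomorph : OpenPartialHomeomorph E E).target = ball 0 1 := rfl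

/-- The **puncture expansion** `h = radialMap η : E ∖ 0 → E ∖ B̄(0, 1/8)`, `t • u ↦ η t • u`; the
identity on `‖z‖ ≥ 3/4`. [folklore] -/
def punctureExpansion : E → E := radialMap punctureProfile

/-- The inverse of the puncture expansion (on `‖y‖ > 1/8`). [folklore] -/
def punctureExpansionInv : E → E := radialMap punctureProfileInv

/-- `‖h z‖ = η ‖z‖` for `z ≠ 0`. [folklore] -/
theorem norm_punctureExpansion {z : E} (hz : z ≠ 0) :
    ‖punctureExpansion z‖ = punctureProfile ‖z‖ := by
  rw [punctureExpansion, norm_radialMap _ hz, abs_of_pos (punctureProfile_pos (norm_pos_iff.2 hz))]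

/-- `‖h z‖ > 1/8` for `z ≠ 0`. [folklore] -/
theorem lt_norm_punctureExpansion {z : E} (hz : z ≠ 0) : 8⁻¹ < ‖punctureExpansion z‖ := by
  rw [norm_punctureExpansion hz, ← one_div]
  exact punctureProfile_gt (norm_pos_iff.2 hz)

/-- `‖h z‖ < 1` forces `‖z‖ < 1` (`z ≠ 0`). [folklore] -/
theorem norm_lt_one_of_norm_punctureExpansion_lt_one {z : E} (hz : z ≠ 0)
    (h : ‖punctureExpansion z‖ < 1) : ‖z‖ < 1 := by
  rw [norm_punctureExpansion hz] at h
  exact lt_one_of_punctureProfile_lt_one h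

/-- `h (t • u) = η t • u` for a unit vector `u` and `t > 0`. [folklore] -/
theorem punctureExpansion_smul {u : E} (hu : ‖u‖ = 1) {t : ℝ} (ht : 0 < t) :
    punctureExpansion (t • u) = punctureProfile t • u := radialMap_smul _ hu ht

/-- `h z = z` for `‖z‖ ≥ 3/4`. [folklore] -/
theorem punctureExpansion_eq_self {z : E} (hz : 3 / 4 ≤ ‖z‖) : punctureExpansion z = z :=
  radialMap_eq_self _ (punctureProfile_of_ge hz)

/-- `h⁻¹ y = y` for `‖y‖ ≥ 3/4`. [folklore] -/
theorem punctureExpansionInv_eq_self {y : E} (hy : 3 / 4 ≤ ‖y‖) : punctureExpansionInv y = y := by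
  refine radialMap_eq_self _ ?_
  conv_lhs => rw [← punctureProfile_of_ge hy]
  exact punctureProfileInv_punctureProfile _

/-- `h⁻¹ (h z) = z` for `z ≠ 0`. [folklore] -/
theorem punctureExpansionInv_punctureExpansion {z : E} (hz : z ≠ 0) :
    punctureExpansionInv (punctureExpansion z) = z := by
  rw [punctureExpansionInv, punctureExpansion,
    radialMap_radialMap _ _ hz (punctureProfile_pos (norm_pos_iff.2 hz)),
    punctureProfileInv_punctureProfile, mul_inv_cancel₀ (norm_ne_zero_iff.2 hz), one_smul]

/-- `h (h⁻¹ y) = y` for `‖y‖ > 1/8`. [folklore] -/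
theorem punctureExpansion_punctureExpansionInv {y : E} (hy : 8⁻¹ < ‖y‖) :
    punctureExpansion (punctureExpansionInv y) = y := by
  have hy0 : y ≠ 0 := by
    rintro rfl
    rw [norm_zero] at hy
    norm_num at hy
  obtain ⟨t, ht, hty⟩ := exists_punctureProfile_eq (s := ‖y‖) (by rw [one_div]; exact hy)
  have hinv : punctureProfileInv ‖y‖ = t := by rw [← hty, punctureProfileInv_punctureProfile]
  rw [punctureExpansion, punctureExpansionInv, radialMap_radialMap _ _ hy0 (by rw [hinv]; exact ht),
    hinv, hty, mul_inv_cancel₀ (norm_ne_zero_iff.2 hy0), one_smul]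

/-- `h⁻¹ y ≠ 0` for `‖y‖ > 1/8`. [folklore] -/
theorem punctureExpansionInv_ne_zero {y : E} (hy : 8⁻¹ < ‖y‖) : punctureExpansionInv y ≠ 0 := by
  intro h
  have h' := congrArg (punctureExpansion : E → E) h
  rw [punctureExpansion_punctureExpansionInv hy, punctureExpansion, radialMap_zero] at h'
  rw [h', norm_zero] at hy
  norm_num at hy

/-- `h` is smooth away from the origin. [folklore] -/
theorem contDiffAt_punctureExpansion {z : E} (hz : z ≠ 0) :
    ContDiffAt ℝ ∞ (punctureExpansion : E → E) z :=
  contDiffAt_radialMap hz (contDiffAt_punctureProfile (norm_pos_iff.2 hz))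

/-- `h` is smooth on `E ∖ {0}`. [folklore] -/
theorem contDiffOn_punctureExpansion : ContDiffOn ℝ ∞ (punctureExpansion : E → E) {0}ᶜ :=
  fun _ hz => (contDiffAt_punctureExpansion hz).contDiffWithinAt

/-- `h⁻¹` is smooth at the points `‖y‖ > 1/8`. [folklore] -/
theorem contDiffAt_punctureExpansionInv {y : E} (hy : 8⁻¹ < ‖y‖) :
    ContDiffAt ℝ ∞ (punctureExpansionInv : E → E) y := by
  have hy0 : y ≠ 0 := by
    rintro rfl
    rw [norm_zero] at hy
    norm_num at hy
  obtain ⟨t, ht, hty⟩ := exists_punctureProfile_eq (s := ‖y‖) (by rw [one_div]; exact hy)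
  refine contDiffAt_radialMap hy0 ?_
  rw [← hty]
  exact contDiffAt_punctureProfileInv ht

/-- `h⁻¹` is smooth on `E ∖ B̄(0, 1/8)`. [folklore] -/
theorem contDiffOn_punctureExpansionInv :
    ContDiffOn ℝ ∞ (punctureExpansionInv : E → E) (closedBall 0 8⁻¹)ᶜ := fun _ hy =>
  (contDiffAt_punctureExpansionInv (by simpa using hy)).contDiffWithinAt

/-- The puncture expansion as a partial homeomorphism `E ∖ 0 ≃ E ∖ B̄(0, 1/8)`, smooth with smooth
inverse (`contDiffOn_punctureExpansion`, `contDiffOn_punctureExpansionInv`). [folklore] -/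
def punctureExpansionPartialHomeomorph : OpenPartialHomeomorph E E where
  toFun := punctureExpansion
  invFun := punctureExpansionInv
  source := {0}ᶜ
  target := (closedBall 0 8⁻¹)ᶜ
  map_source' _ hz := by simpa using lt_norm_punctureExpansion hz
  map_target' _ hy := punctureExpansionInv_ne_zero (by simpa using hy)
  left_inv' _ hz := punctureExpansionInv_punctureExpansion hz
  right_inv' _ hy := punctureExpansion_punctureExpansionInv (by simpa using hy)
  open_source := isOpen_compl_singleton
  open_target := isClosed_closedBall.isOpen_compl
  continuousOn_toFun := contDiffOn_punctureExpansion.continuousOn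
  continuousOn_invFun := contDiffOn_punctureExpansionInv.continuousOn

/-- `punctureExpansionPartialHomeomorph` acts as `h`. [folklore] -/
@[simp] theorem punctureExpansionPartialHomeomorph_coe :
    ⇑(punctureExpansionPartialHomeomorph : OpenPartialHomeomorph E E) = punctureExpansion := rfl

/-- The inverse of `punctureExpansionPartialHomeomorph` acts as `h⁻¹`. [folklore] -/
@[simp] theorem punctureExpansionPartialHomeomorph_symm_coe :
    ⇑(punctureExpansionPartialHomeomorph : OpenPartialHomeomorph E E).symm = punctureExpansionInv :=
  rfl

/-- The source of `punctureExpansionPartialHomeomorph` is `E ∖ {0}`. [folklore] -/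
@[simp] theorem punctureExpansionPartialHomeomorph_source :
    (punctureExpansionPartialHomeomorph : OpenPartialHomeomorph E E).source = {0}ᶜ := rfl

/-- The target of `punctureExpansionPartialHomeomorph` is `E ∖ B̄(0, 1/8)`. [folklore] -/
@[simp] theorem punctureExpansionPartialHomeomorph_target :
    (punctureExpansionPartialHomeomorph : OpenPartialHomeomorph E E).target = (closedBall 0 8⁻¹)ᶜ :=
  rfl

/-- **The link between the two maps** (the stereographic inversion `t • u ↦ (4/(1-t)) • u` of
Kervaire–Milnor's parameter): `h (t • u) = g ((4 / (1 - t)) • u)` for `0 < t < 1`, `‖u‖ = 1`.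
[folklore] -/
theorem punctureExpansion_smul_eq {u : E} (hu : ‖u‖ = 1) {t : ℝ} (ht : t ∈ Ioo (0 : ℝ) 1) :
    punctureExpansion (t • u) = ballContraction ((4 / (1 - t)) • u) := by
  have h4 : 0 < 4 / (1 - t) := div_pos (by norm_num) (by linarith [ht.2])
  rw [punctureExpansion_smul hu ht.1, ballContraction_smul hu h4,
    punctureProfile_eq_ballProfile ht.2]

end Maps


end Literature.Topology.FourManifolds

end
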